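import Mathlib
import Summits.QuantumFields.BalabanUV.Beta.AnalyticWalkSum216RowResolvent
import Literature.MathematicalPhysics.QuantumFieldTheory.Balaban1983to89.B9SectECov

/-!
# [Balaban1985BackgroundPropagators] (3.186) p. 432 «G̃₂ = G₂ − G₂Q̃*(Q̃G₂Q̃*)⁻¹Q̃G₂» and p. 422 «The operators (QGQ*)⁻¹, or
# (QG₁Q*)⁻¹, can be analyzed in the same way as the operator (Q′G′²Q′*)⁻¹» — THE CONSTRAINED (PROJECTION) LAYER IN THE
# VOLUME-FREE ROW-DATA CURRENCY: row data of the decorated G₂-family + the co-owner's ω-expansion data for the coarse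
# operator «Q̃G₂Q̃* − 1» ⟹ row data of the G̃₂-family, summing at s ≡ 1 to G₂ − G₂Q̃*(Q̃G₂Q̃*)⁻¹Q̃G₂ = `flucCov K Q̃`
# (cell topic `Summits/QuantumFields/BalabanUV/Beta`; row-D4 NODE A.4 leaf A.4.5 in abstract form; siblings
# `AnalyticWalkSum216RowResolvent(Omega∕Proj)`, `AnalyticWalkSum216RowPerturbation`)

HONEST FRAMING (cell rule).  Discharging `BetaPertH` makes Bałaban's UV stability UNCONDITIONAL — a real constructive-QFT
result; NOT the continuum limit, NOT the Clay problem.  This module discharges NOTHING of `BetaPertH`.  [folklore]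
bookkeeping: the middle link of the abstract chain G̃₀ →(`…RowPerturbation`)→ G₂ →(THIS FILE)→ G̃₂ →(`…RowResolvent*`)→
G̃₃(x) of the row-D4 apex outline (`HOME/b2b-balaban-beta-an4/g38/OUTLINE-D4-NODE-A.md` v1.4; census `BETA/REMAINDER-BETA.md`
§10).  It is THEOREM A of the sibling at `x = X = 1` (the recombination `G − 1·G·(P·Ω·Q)·G`) with the unit-lattice family
expanding the inverse of the COARSE operator: the co-owner's ω-machinery (`UnitLatticeOmegaRowData.rowData_decFamilyΩ` ∕
`termSum_decFamilyΩ_one`) applies to ANY finite piece family `Kp` and yields `(1 + Σ_ω Kp_ω)⁻¹`; with `Σ_ω Kp_ω = «Q̃G₂Q̃* − 1»`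
(in the one-index-type convention: minus the coarse-block identity) this is the (QGQ*)⁻¹-type factor of [13] p. 422∕p. 432,
and the recombined sum is (3.186) — identified with b09's bordered-inverse block `flucCov K Q̃` by `B9SectECov.eq_3186_scalar`
BY NAME under the DICTIONARY hypothesis `hdict` (how the rectangular constraint `Q̃ : μ × Y` sits inside the square sandwich
`P, Q : Y × Y` of the siblings' convention — a finite-dimensional block identity of the instance, displayed, not hidden).
Nothing of Bałaban's operators is instantiated ((T3) and NODE O.2 untouched); NO class change on any GAPS row; readiness
width 0 unchanged; NOT summit progress.  Unit `b2b-balaban-beta-an4-g38` (owner of `BINDER-OWNERS.md` row D4); `GAPS.md`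
C-an4-96.

CITATION HEADER (lean-in-tree rule).  [13] = T. Bałaban, *Propagators for lattice gauge theories in a background field*,
Commun. Math. Phys. **99**, 389–434 (1985) [Balaban1985BackgroundPropagators], p. 432 [PDF 44] (render
`HOME/b2b-balaban-ref1/pages/1985-cmp99-background-propagators/…-p044-x2.png`, READ AS IMAGE by this seat 2026-08-20),
verbatim: *"We have G̃₂ = G₂ − G₂Q̃*(Q̃G₂Q̃*)^{−1}Q̃G₂. (3.186) … This way we can express C^{(k)}(Λ) in terms of the operators
of the type G′, (Q′G′²Q′*)⁻¹, G, (QGQ*)⁻¹. Expanding these into random walks we get a random walk expansion of C^{(k)}(Λ)."*;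
p. 422 [PDF 34] (render `…-p034-x2.png`, READ AS IMAGE today): *"The operators (QGQ*)⁻¹, or (QG₁Q*)⁻¹, can be analyzed in the
same way as the operator (Q′G′²Q′*)⁻¹. We will not repeat these considerations here, let us write only bounds."* (G-B9-15:
asserted by analogy).  Nothing printed is asserted; the displays LOCATE the operation.

WHAT IS CERTIFIED HERE (kernel, sorry-free; [folklore]).
§1 THEOREM A at `x = 1`: `rowData_constrained` (constant `ρ_G + ρ_G·(c_P(ρ_Ωc_Q))·ρ_G`), END `wrs_constrained_sub`,
   `termSum_constrained_eq` (sum `= G − G·(P·Ω(σ)·Q)·G` for whatever the unit-lattice family sums to), and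
   `termSum_constrained_flucCov` (with `P·Ω(σ)·Q = Q̃ᵀ(Q̃G(σ)Q̃ᵀ)⁻¹Q̃` and `G(σ) = (K + a·Q̃ᵀQ̃)⁻¹`: `= flucCov K Q̃`, b09's
   `eq_3186_scalar` BY NAME).
§2 THEOREM B level over the co-owner's ω-expansion for an ARBITRARY finite piece family `Kp` (their binders VERBATIM):
   **`rowData_constrainedΩ`** (row data for every frozen decoration and free cell) and **`termSum_constrainedΩ_flucCov`**
   (at `s ≡ 1`: `= flucCov K Q̃` under `hdict : P(1 + Σ_ωKp_ω)⁻¹Q = Q̃ᵀ(Q̃𝒢Q̃ᵀ)⁻¹Q̃`, `𝒢 = Σ_ωG_ω = (K + a·Q̃ᵀQ̃)⁻¹`).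
§3 Non-vacuity at THEOREM A level.
NOT CLAIMED.  Any expansion of Bałaban's G₂ or of (Q̃G₂Q̃*)⁻¹ (hypotheses); the dictionary `hdict` for Bałaban's lattices;
positivity (existence of the coarse local inverses = the (1.44)∕(3.132)-type lower bound, G-B9-15 — the co-owner's
`UnitLatticeProjectionWalk.sandwich_coercive_of_reconstruction` is the located engine); k-uniformity (NODE O.2).
NOT summit progress.
PRIOR ART IN THE TREE (searched 2026-08-20): the siblings (THEOREM A∕B, `wrs_Rem₂_le`); `B9SectECov.eq_3186(_scalar)` (b09
gen 13: (3.186) as a bordered-inverse identity — USED BY NAME); `UnitLatticeProjectionWalk` (d4-p3: the x-uniform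
projection inversion — complementary, undecorated).
-/

namespace Summit.QuantumFields.BalabanUV.Beta.AnalyticWalkSum216RowConstrained

open Metric Set
open scoped Matrix
open Literature.MathematicalPhysics.QuantumFieldTheory.Balaban1983to89
open B13PerturbativeStep (WRS WeightHyp wrs)
open Literature.MathematicalPhysics.QuantumFieldTheory.Balaban1983to89.Beta.CompositionSingular (flucCov)
open Literature.MathematicalPhysics.QuantumFieldTheory.Balaban1983to89.B9SectECov (eq_3186_scalar)
open Summit.QuantumFields.BalabanUV.Beta.AnalyticWalkSum216 (termSum majSum)
open Summit.QuantumFields.BalabanUV.Beta.AnalyticWalkSum216Recomb (recombTerm recombMaj)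
open Summit.QuantumFields.BalabanUV.Beta.AnalyticWalkSum216RowData (RowData)
open Summit.QuantumFields.BalabanUV.Beta.AnalyticWalkSum216RowNeumann (termSum_recomb')
open Summit.QuantumFields.BalabanUV.Beta.AnalyticWalkSum216RowResolvent
open Summit.QuantumFields.BalabanUV.Beta.UnitLatticeWalkInversion (Hd Pj Ptot)
open Summit.QuantumFields.BalabanUV.Beta.UnitLatticeOmegaTerms
open Summit.QuantumFields.BalabanUV.Beta.UnitLatticeOmegaTube (listLen listLen_nonneg decΩ)
open Summit.QuantumFields.BalabanUV.Beta.UnitLatticeOmegaPaths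
open Summit.QuantumFields.BalabanUV.Beta.UnitLatticeOmegaRowData

noncomputable section

variable {Y : Type*} [Fintype Y] [DecidableEq Y] {W V : Type*} {κ : ℝ} {d : Y → Y → ℝ} {R : ℝ}

/-! ## §1 THEOREM A at `x = 1`: the constrained recombination `G − G·(P·Ω·Q)·G` -/

section TheoremA

variable {TG : W → ℂ → Matrix Y Y ℂ} {mG : W → Y → Y → ℝ} {ρG : ℝ}
  {TΩ : V → ℂ → Matrix Y Y ℂ} {mΩ : V → Y → Y → ℝ} {ρΩ : ℝ} {P Q : Matrix Y Y ℂ} {cP cQ : ℝ}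

omit [DecidableEq Y] in
/-- **Row data of the constrained family** `G − G·(P·Ω·Q)·G` (THEOREM A at `x = X = 1`): constant
`ρ_G + 1·(ρ_G·(c_P(ρ_Ωc_Q))·ρ_G)`, volume-free. [cite: Balaban1985BackgroundPropagators, (3.186) p.432] -/
theorem rowData_constrained [Nonempty Y] (hG : RowData κ d R TG mG ρG) (hΩ : RowData κ d R TΩ mΩ ρΩ)
    (hP : WRS κ d P cP) (hQ : WRS κ d Q cQ) (hw : WeightHyp κ d) (hR : 0 < R) :
    RowData κ d R (recombTerm TG (sandTerm P Q TΩ) 1) (recombMaj mG (sandMaj P Q mΩ) 1)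
      (ρG + 1 * (ρG * (cP * (ρΩ * cQ) * ρG))) :=
  rowData_resolvent hG hΩ hP hQ hw hR (x := 1) (X := 1) (by rw [norm_one])

omit [DecidableEq Y] in
/-- **END (2.16)-shape for the constrained family.** [cite: Balaban1988RG2Cluster, (2.16)–(2.17) p.16] -/
theorem wrs_constrained_sub [Nonempty Y] (hG : RowData κ d R TG mG ρG) (hΩ : RowData κ d R TΩ mΩ ρΩ)
    (hP : WRS κ d P cP) (hQ : WRS κ d Q cQ) (hw : WeightHyp κ d) (hR : 0 < R) {σ : ℂ} (hσ : σ ∈ ball (0 : ℂ) R) :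
    WRS κ d (termSum (recombTerm TG (sandTerm P Q TΩ) 1) σ - termSum (recombTerm TG (sandTerm P Q TΩ) 1) 0)
      (2 * (ρG + 1 * (ρG * (cP * (ρΩ * cQ) * ρG))) / R * ‖σ‖) :=
  (rowData_constrained hG hΩ hP hQ hw hR).wrs_termSum_sub hR hσ

omit [DecidableEq Y] in
/-- **The sum**: `termSum fam σ = G(σ) − G(σ)·(P·Ω(σ)·Q)·G(σ)`, `Ω(σ) = termSum TΩ σ` (no invertibility of anything).
[folklore] -/
theorem termSum_constrained_eq [Nonempty Y] (hG : RowData κ d R TG mG ρG) (hΩ : RowData κ d R TΩ mΩ ρΩ)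
    (hP : WRS κ d P cP) (hQ : WRS κ d Q cQ) (hw : WeightHyp κ d) (hR : 0 < R) {σ : ℂ} (hσ : σ ∈ ball (0 : ℂ) R) :
    termSum (recombTerm TG (sandTerm P Q TΩ) 1) σ =
      termSum TG σ - termSum TG σ * (P * termSum TΩ σ * Q) * termSum TG σ := by
  rw [termSum_recomb' hG (rowData_sandwich hΩ hP hQ hw hR) hw hR 1 hσ, termSum_sandwich hΩ hP hQ hw hR hσ, one_smul]
  simp only [Matrix.mul_assoc]

variable {μ : Type*} [Fintype μ] [DecidableEq μ]

/-- **THE (3.186) IDENTIFICATION, THEOREM A LEVEL.**  If the `G`-family sums to `G(σ) = (K + a·Q̃ᵀQ̃)⁻¹` (the a-regularised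
covariance G₂) and the sandwiched unit-lattice family to `Q̃ᵀ(Q̃G(σ)Q̃ᵀ)⁻¹Q̃` (the (QGQ*)⁻¹-factor, [13] p. 422∕432), then the
constrained family sums to `flucCov K Q̃` = G̃₂ — b09's `eq_3186_scalar` BY NAME (its nonsingularity hypotheses displayed).
[cite: Balaban1985BackgroundPropagators, (3.186) p.432] -/
theorem termSum_constrained_flucCov [Nonempty Y] (hG : RowData κ d R TG mG ρG) (hΩ : RowData κ d R TΩ mΩ ρΩ)
    (hP : WRS κ d P cP) (hQ : WRS κ d Q cQ) (hw : WeightHyp κ d) (hR : 0 < R) {σ : ℂ} (hσ : σ ∈ ball (0 : ℂ) R)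
    (K : Matrix Y Y ℂ) (Qt : Matrix μ Y ℂ) (a : ℂ) (hKa : IsUnit (K + a • (Qtᵀ * Qt)).det)
    (hPr : IsUnit (Qt * (K + a • (Qtᵀ * Qt))⁻¹ * Qtᵀ).det) (hGsum : termSum TG σ = (K + a • (Qtᵀ * Qt))⁻¹)
    (hΩsum : P * termSum TΩ σ * Q = Qtᵀ * (Qt * termSum TG σ * Qtᵀ)⁻¹ * Qt) :
    termSum (recombTerm TG (sandTerm P Q TΩ) 1) σ = flucCov K Qt := by
  rw [termSum_constrained_eq hG hΩ hP hQ hw hR hσ, hΩsum, hGsum, eq_3186_scalar K Qt a hKa hPr]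
  simp only [Matrix.mul_assoc]

end TheoremA

/-! ## §2 THEOREM B level: over the co-owner's ω-expansion for an arbitrary finite coarse piece family -/

section TheoremB

variable {B Ω Ω' Δ μ : Type*} [Fintype B] [Fintype Ω] [Fintype Ω'] [DecidableEq Ω'] [DecidableEq Δ]
  [Fintype μ] [DecidableEq μ]

/-- **ROW DATA OF THE CONSTRAINED FAMILY, THEOREM B LEVEL.**  (T3)-type input `hG` for the decorated `G`-pieces; the
co-owner's `rowData_decFamilyΩ` binders VERBATIM for an ARBITRARY finite coarse piece family `Kp : Ω′ → Matrix`
(block-locality, near families, partition, cells, threads∕credits, budgets `K₁`, `Φ`, local inverses with budget `C_L`,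
smallness `C_L((2N/M)K₁ + Φ) < 1`); localised sandwich `P`, `Q`.  Conclusion: for every frozen decoration and free cell
the family `G − G·(P·Ω·Q)·G` is row data on `‖σ‖ < e^{κ₁}` with the volume-free constant
`ρ_G + 1·(ρ_G·(c_P·(e^{κ₁Pk}NC_L(1 − C_L((2N/M)K₁ + Φ))⁻¹·c_Q)·ρ_G)`. [cite: Balaban1985BackgroundPropagators, (3.186) p.432] -/
theorem rowData_constrainedΩ [Nonempty Y] (hw : WeightHyp κ d) (hsymm : ∀ a b, d a b = d b a)
    (G : Ω → Matrix Y Y ℂ) (DG : Ω → Finset Δ) {κ₁ ρG : ℝ} (hκ₁ : 0 ≤ κ₁)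
    (hG : ∀ i, ∑ j, (∑ ω, pieceMaj κ₁ G DG ω i j) * Real.exp (κ * d i j) ≤ ρG)
    (P Q : Matrix Y Y ℂ) {cP cQ : ℝ} (hP : WRS κ d P cP) (hQ : WRS κ d Q cQ)
    (Kp : Ω' → Matrix Y Y ℂ) (Dω : Ω' → Finset Y) (hKdom : ∀ ω k l, Kp ω k l ≠ 0 → k ∈ Dω ω) (near : B → Finset Ω')
    (h : B → Y → ℝ) (E : B → Finset Y) (L : B → Matrix Y Y ℂ) (hsupp : ∀ b y, y ∉ E b → h b y = 0)
    (habs : ∀ b y, |h b y| ≤ 1) {M N C_L K₁ Φ r D Df Rr : ℝ} (hM : 0 < M)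
    (hLip : ∀ b y y', |h b y - h b y'| ≤ d y y' / M) (hN : ∀ y, ((Finset.univ.filter fun b => y ∈ E b).card : ℝ) ≤ N)
    (hC : 0 ≤ C_L) (hr : 0 < r) (hRD : r + D ≤ Rr) (hRf : r + Df ≤ Rr) (cellOf : Y → Δ) {Pk : ℕ}
    (hpack : ∀ a : Y, ∃ S : Finset Δ, S.card ≤ Pk ∧ ∀ z, d a z ≤ Rr → cellOf z ∈ S)
    (hdiam : ∀ b, ∀ z ∈ E b, ∀ z' ∈ E b, d z z' ≤ D) (thr : Ω' → List Y)
    (hthr : ∀ ω, ∀ z ∈ Dω ω, ∃ p ∈ thr ω, d z p ≤ Df) (cr : Ω' → ℝ) (hcr : ∀ ω, 3 * listLen d (thr ω) + 2 * Df ≤ cr ω)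
    (hL : ∀ b, WRS (κ + κ₁ * (Pk / r)) d (L b) C_L)
    (hK₁ : ∀ k, ∑ ω, ∑ l, ‖Kp ω k l‖ * d k l * Real.exp ((κ + κ₁ * (Pk / r)) * d k l + κ₁ * (Pk / r) * cr ω) ≤ K₁)
    (hΦ : ∀ k, ∑ ω, ∑ l, (∑ b, if ω ∈ near b then (0 : ℝ) else |h b l|) * ‖Kp ω k l‖
      * Real.exp ((κ + κ₁ * (Pk / r)) * d k l + κ₁ * (Pk / r) * cr ω) ≤ Φ)
    (hρ : C_L * (2 * N / M * K₁ + Φ) < 1) (τ : Δ → ℂ) (hτ : ∀ δ, ‖τ δ‖ ≤ Real.exp κ₁) (Δ₀ : Δ) :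
    RowData κ d (Real.exp κ₁)
      (recombTerm (decPieces G DG τ Δ₀) (sandTerm P Q (decFamilyΩ cellOf E Dω h Kp near L τ Δ₀)) 1)
      (recombMaj (pieceMaj κ₁ G DG)
        (sandMaj P Q (decMajΩ (Real.exp (κ₁ * Pk)) (κ₁ * (Pk / r)) d cr h Kp near L)) 1)
      (ρG + 1 * (ρG * (cP * (Real.exp (κ₁ * Pk) * (N * C_L) * (1 - C_L * (2 * N / M * K₁ + Φ))⁻¹ * cQ) * ρG))) :=
  rowData_constrained (rowData_decPieces G DG hG τ hτ Δ₀)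
    (rowData_decFamilyΩ hw hsymm Kp Dω hKdom near h E L hsupp habs hM hLip hN hC hκ₁ hr hRD hRf cellOf hpack hdiam thr
      hthr cr hcr hL hK₁ hΦ hρ τ hτ Δ₀) hP hQ hw (Real.exp_pos κ₁)

/-- **THE (3.186) IDENTIFICATION, THEOREM B LEVEL.**  With moreover `κ₁ > 0`, `0 ≤ Df`, the co-owner's resummation data
for the coarse pieces (`Σ_b h_b² = 1`, `P_bL_b = L_b`, `P_b(1 + Kp_{near b})P_bL_b = P_b`), the `G`-pieces summing to
`(K + a·Q̃ᵀQ̃)⁻¹` (the a-regularised G₂, b09's convention) with b09's two nonsingularity inputs, and the DICTIONARY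
`hdict : P(1 + Σ_ωKp_ω)⁻¹Q = Q̃ᵀ(Q̃𝒢Q̃ᵀ)⁻¹Q̃` (the coarse pieces expand the (QGQ*)⁻¹-factor in the square-sandwich convention):
at `τ ≡ 1`, `σ = 1` the constrained family SUMS to `flucCov K Q̃` = G̃₂ of (3.186).  Chain: `rowData_decFamilyΩ` +
`resummation_identity₂` + `wrs_Rem₂_le` + `termSum_decFamilyΩ_one` (co-owner ∕ sibling) + §1 + b09's `eq_3186_scalar` BY NAME.
[cite: Balaban1985BackgroundPropagators, (3.186) p.432] -/
theorem termSum_constrainedΩ_flucCov [Nonempty Y] (hw : WeightHyp κ d) (hsymm : ∀ a b, d a b = d b a)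
    (G : Ω → Matrix Y Y ℂ) (DG : Ω → Finset Δ) {κ₁ ρG : ℝ} (hκ₁ : 0 < κ₁)
    (hG : ∀ i, ∑ j, (∑ ω, pieceMaj κ₁ G DG ω i j) * Real.exp (κ * d i j) ≤ ρG)
    (P Q : Matrix Y Y ℂ) {cP cQ : ℝ} (hP : WRS κ d P cP) (hQ : WRS κ d Q cQ)
    (K : Matrix Y Y ℂ) (Qt : Matrix μ Y ℂ) (a : ℂ) (hKa : IsUnit (K + a • (Qtᵀ * Qt)).det)
    (hPr : IsUnit (Qt * (K + a • (Qtᵀ * Qt))⁻¹ * Qtᵀ).det) (hGsum : Ktot G = (K + a • (Qtᵀ * Qt))⁻¹)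
    (Kp : Ω' → Matrix Y Y ℂ) (hdict : P * (1 + Ktot Kp)⁻¹ * Q = Qtᵀ * (Qt * Ktot G * Qtᵀ)⁻¹ * Qt)
    (Dω : Ω' → Finset Y) (hKdom : ∀ ω k l, Kp ω k l ≠ 0 → k ∈ Dω ω) (near : B → Finset Ω')
    (h : B → Y → ℝ) (E : B → Finset Y) (L : B → Matrix Y Y ℂ) (hsupp : ∀ b y, y ∉ E b → h b y = 0)
    (habs : ∀ b y, |h b y| ≤ 1) (hsum2 : ∀ y, ∑ b, h b y ^ 2 = 1) (hPL : ∀ b, Pj E b * L b = L b)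
    (hloc : ∀ b, Pj E b * (1 + Knear Kp near b) * Pj E b * L b = Pj E b)
    {M N C_L K₁ Φ r D Df Rr : ℝ} (hM : 0 < M)
    (hLip : ∀ b y y', |h b y - h b y'| ≤ d y y' / M) (hN : ∀ y, ((Finset.univ.filter fun b => y ∈ E b).card : ℝ) ≤ N)
    (hC : 0 ≤ C_L) (hr : 0 < r) (hRD : r + D ≤ Rr) (hRf : r + Df ≤ Rr) (hDf : 0 ≤ Df) (cellOf : Y → Δ) {Pk : ℕ}
    (hpack : ∀ a : Y, ∃ S : Finset Δ, S.card ≤ Pk ∧ ∀ z, d a z ≤ Rr → cellOf z ∈ S)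
    (hdiam : ∀ b, ∀ z ∈ E b, ∀ z' ∈ E b, d z z' ≤ D) (thr : Ω' → List Y)
    (hthr : ∀ ω, ∀ z ∈ Dω ω, ∃ p ∈ thr ω, d z p ≤ Df) (cr : Ω' → ℝ) (hcr : ∀ ω, 3 * listLen d (thr ω) + 2 * Df ≤ cr ω)
    (hL : ∀ b, WRS (κ + κ₁ * (Pk / r)) d (L b) C_L)
    (hK₁ : ∀ k, ∑ ω, ∑ l, ‖Kp ω k l‖ * d k l * Real.exp ((κ + κ₁ * (Pk / r)) * d k l + κ₁ * (Pk / r) * cr ω) ≤ K₁)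
    (hΦ : ∀ k, ∑ ω, ∑ l, (∑ b, if ω ∈ near b then (0 : ℝ) else |h b l|) * ‖Kp ω k l‖
      * Real.exp ((κ + κ₁ * (Pk / r)) * d k l + κ₁ * (Pk / r) * cr ω) ≤ Φ)
    (hρ : C_L * (2 * N / M * K₁ + Φ) < 1) (Δ₀ : Δ) :
    termSum (recombTerm (decPieces G DG (fun _ => (1 : ℂ)) Δ₀)
        (sandTerm P Q (decFamilyΩ cellOf E Dω h Kp near L (fun _ => (1 : ℂ)) Δ₀)) 1) 1 = flucCov K Qt := by
  have hτ : ∀ δ : Δ, ‖(fun _ => (1 : ℂ)) δ‖ ≤ Real.exp κ₁ := fun _ => by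
    rw [norm_one]
    exact Real.one_le_exp hκ₁.le
  have h1 : (1 : ℂ) ∈ ball (0 : ℂ) (Real.exp κ₁) := by
    rw [mem_ball_zero_iff, norm_one]
    exact Real.one_lt_exp_iff.2 hκ₁
  have hδ : 0 ≤ κ₁ * (Pk / r) := mul_nonneg hκ₁.le (div_nonneg (Nat.cast_nonneg Pk) hr.le)
  have hcr0 : ∀ ω, 0 ≤ cr ω := fun ω =>
    le_trans (add_nonneg (mul_nonneg (by norm_num) (listLen_nonneg d hw.nonneg (thr ω)))
      (mul_nonneg (by norm_num) hDf)) (hcr ω)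
  have hGr := rowData_decPieces G DG hG (fun _ => (1 : ℂ)) hτ Δ₀ (κ := κ) (d := d)
  have hΩ := rowData_decFamilyΩ hw hsymm Kp Dω hKdom near h E L hsupp habs hM hLip hN hC hκ₁.le hr hRD hRf cellOf hpack
    hdiam thr hthr cr hcr hL hK₁ hΦ hρ (fun _ => (1 : ℂ)) hτ Δ₀
  have hid := resummation_identity₂ Kp near h E L hsum2 hsupp hPL hloc
  have hRem := wrs_Rem₂_le hw hδ cr hcr0 Kp near h E L hsupp habs hM hLip hN hC hL hK₁ hΦ
  have hΩ1 := termSum_decFamilyΩ_one hw hid hRem hρ cellOf E Dω Δ₀ hΩ h1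
  have hG1 : termSum (decPieces G DG (fun _ => (1 : ℂ)) Δ₀) 1 = Ktot G := termSum_decPieces_one G DG Δ₀
  have hΩsum : P * termSum (decFamilyΩ cellOf E Dω h Kp near L (fun _ => (1 : ℂ)) Δ₀) 1 * Q =
      Qtᵀ * (Qt * termSum (decPieces G DG (fun _ => (1 : ℂ)) Δ₀) 1 * Qtᵀ)⁻¹ * Qt := by
    rw [hΩ1, hG1, hdict]
  exact termSum_constrained_flucCov hGr hΩ hP hQ hw (Real.exp_pos κ₁) h1 K Qt a hKa hPr (by rw [hG1, hGsum]) hΩsum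

end TheoremB

/-! ## §3 Non-vacuity at THEOREM A level -/

/-- The hypotheses of `rowData_constrained` ∕ `wrs_constrained_sub` are jointly satisfiable (one site, both families the
one-term family `T(σ) = σ` on the unit disc, `P = Q = 1`). [folklore] -/
example : WRS (n := Unit) 0 (fun _ _ => 0)
    (termSum (recombTerm (fun (_ : Unit) (σ : ℂ) => fun (_ _ : Unit) => σ)
        (sandTerm 1 1 (fun (_ : Unit) (σ : ℂ) => fun (_ _ : Unit) => σ)) (1 : ℂ)) (1 / 2) -
      termSum (recombTerm (fun (_ : Unit) (σ : ℂ) => fun (_ _ : Unit) => σ)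
        (sandTerm 1 1 (fun (_ : Unit) (σ : ℂ) => fun (_ _ : Unit) => σ)) (1 : ℂ)) 0)
    (2 * (1 + 1 * (1 * (1 * (1 * 1) * 1))) / 1 * ‖(1 / 2 : ℂ)‖) := by
  have hw : WeightHyp (n := Unit) 0 (fun _ _ => 0) := ⟨le_rfl, fun _ => rfl, fun _ _ => le_rfl, fun _ _ _ => by simp⟩
  have h := AnalyticWalkSum216RowData.rowData_example
  refine wrs_constrained_sub h h (B13PerturbativeStep.WRS.one hw) (B13PerturbativeStep.WRS.one hw) hw one_pos ?_
  rw [mem_ball_zero_iff]; norm_num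

end

end Summit.QuantumFields.BalabanUV.Beta.AnalyticWalkSum216RowConstrained
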